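import Summits.CriticalPhenomena.CardyFormulaZ2.Theorems.HalfPlaneMarkDensityLaw.Negative.MarkEvents
import Literature.Probability.Percolation.AnnulusCrossingBoundProofs
import Literature.Probability.Percolation.HarrisTheorem
import Literature.Probability.Percolation.PlanarDuality
import Literature.Probability.Percolation.RSW

/-!
# Line `Sketch`, converse direction — percolation inputs (crux `HalfPlaneMarkDensityLaw`,
# stmt-CriticalPhenomena-5661): a-priori bounds on the lattice mark density and on short-arc crossings

Support lemmas for `HalfPlaneMarkDensityLaw → C⁺` (collinear half-plane Cardy), complementing the
line's reduction `C⁺ → HalfPlaneMarkDensityLaw`: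

* `firstHit_subset_liso` — the crux's event `E(k) = firstHit halfPlane (rowIcc α β) γ k` is contained
  in the left-isolated arm event at `(k,0)` to distance `R` as soon as the source arc lies left of the
  half-box and the excluded segment covers its bottom-left side (`β < k − R`, `γ ≤ k − R`); hence, with
  the two-arm point bound (STUB A of the line, taken here as a hypothesis `hA`),
  `P[E(k)] ≤ C/R` (`measureReal_firstHit_le_of_twoArm`) — the DOMINATION `n · m_n(k) ≤ D(x)` for
  `k ≥ ⌊xn⌋` used in the reverse-Fatou step.
* `stub_shortArc` (registered as a stub of the crux item) — the SHORT-ARC bound: `P[A_n ↔ [⌊cn⌋,⌊xn⌋]×{0} in ℤ×ℕ] ≤ (4(x−c)/(c−b))^α`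
  for `x − c ≤ (c−b)/8` and `n` large, from the tree's polynomial annulus-crossing decay
  `annulusOpenCrossing_half_le_holds` (the open path from the far arc `A_n` to the short window crosses
  the annulus around the window; stopped at its first exit it is an `annulusOpenCrossing`).
-/

noncomputable section

namespace Summit.CriticalPhenomena.CardyFormulaZ2.Cruxes.HalfPlaneMarkDensityLaw.SketchLine

open Literature.Probability.Percolation Literature.Probability.LatticeModels
open MeasureTheory Filter Set
open scoped Topology
open Summit.CriticalPhenomena.CardyFormulaZ2.Theorems.HalfPlaneMarkDensityLaw.Negative

namespace Converse

/-! ### The left-isolated arm event (same vocabulary as STUB A) -/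

/-- The half-box `Λ⁺_R(k) = [k−R, k+R] × [0, R]`. [folklore] -/
def hb (k : ℤ) (R : ℕ) : Set (Site 2) :=
  {v : Site 2 | 0 ≤ v 1 ∧ v 1 ≤ (R : ℤ) ∧ k - R ≤ v 0 ∧ v 0 ≤ k + R}

/-- The rim (left, right and top sides) of the half-box. [folklore] -/
def rim (k : ℤ) (R : ℕ) : Set (Site 2) :=
  {v : Site 2 | v 0 = k - R ∨ v 0 = k + R ∨ v 1 = (R : ℤ)}

/-- Left-isolated arm at `(k,0)` to distance `R` (literally the event of STUB A). [folklore] -/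
def liso (k : ℤ) (R : ℕ) : Set (BondConfig (Site 2)) :=
  openCrossing (hb k R) {bpt k} (rim k R) \ openCrossing (hb k R) (rowIcc (k - R) (k - 1)) {bpt k}

/-- The half-box lies in the half-plane. [folklore] -/
theorem hb_subset_halfPlane (k : ℤ) (R : ℕ) : hb k R ⊆ halfPlane := fun _ hv ↦ hv.1

/-- **First exit.** A lattice configuration joining `(k,0)` inside the half-plane to a site outside
the half-box joins `(k,0)` to the rim inside the half-box. [folklore] -/
theorem mem_openCrossing_rim_of_openConnIn {ω : BondConfig (Site 2)} (hω : ω ⊆ (zdGraph 2).edgeSet)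
    {k : ℤ} {R : ℕ} {y : Site 2} (hy : y ∉ hb k R) (h : ω ∈ openConnIn halfPlane (bpt k) y) :
    ω ∈ openCrossing (hb k R) {bpt k} (rim k R) := by
  have hk : bpt k ∈ hb k R := by
    simp only [hb, bpt, mem_setOf_eq, Matrix.cons_val_one, Matrix.cons_val_zero,
      Matrix.cons_val_fin_one]
    omega
  obtain ⟨u, w, hu, hw, hwS, huw, hne, hconn⟩ := exists_openConnIn_exit (T := hb k R) hk hy h
  have hadj : (zdGraph 2).Adj u w := by
    have := hω huw
    rwa [SimpleGraph.mem_edgeSet] at this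
  have hurim : u ∈ rim k R := by
    simp only [hb, mem_setOf_eq, not_and_or, not_le] at hu hw
    simp only [halfPlane, mem_setOf_eq] at hwS
    simp only [rim, mem_setOf_eq]
    rcases (zdGraph_adj_iff u w).1 hadj with ⟨i, h | h⟩ <;> fin_cases i <;>
      · have h0 := congr_fun h 0
        have h1 := congr_fun h 1
        simp at h0 h1
        omega
  exact ⟨bpt k, mem_singleton _, u, hurim, openConnIn_mono inter_subset_right _ _ hconn⟩

/-- **`E(k) ⊆ liso k R`** for lattice configurations, when the source arc `[α,β]×{0}` lies left of the
half-box (`β < k − R`) and the excluded segment `[γ,k)×{0}` contains `[k−R,k−1]×{0}` (`γ ≤ k − R`). [folklore] -/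
theorem firstHit_subset_liso {α β γ k : ℤ} {R : ℕ} (hβ : β < k - R) (hγ : γ ≤ k - R)
    {ω : BondConfig (Site 2)} (hω : ω ⊆ (zdGraph 2).edgeSet)
    (h : ω ∈ firstHit halfPlane (rowIcc α β) γ k) : ω ∈ liso k R := by
  obtain ⟨⟨x, hx, y, hy, hxy⟩, hnot⟩ := h
  rw [mem_singleton_iff] at hy
  subst hy
  have hyx : ω ∈ openConnIn halfPlane (bpt k) x := by rw [openConnIn_comm]; exact hxy
  have hxout : x ∉ hb k R := by
    simp only [rowIcc, mem_setOf_eq] at hx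
    simp only [hb, mem_setOf_eq, not_and_or, not_le]
    omega
  refine ⟨mem_openCrossing_rim_of_openConnIn hω hxout hyx, fun hiso ↦ hnot ?_⟩
  obtain ⟨j, hj, z, hz, hjz⟩ := hiso
  rw [mem_singleton_iff] at hz
  subst hz
  refine ⟨x, hx, j, ?_, ?_⟩
  · simp only [rowIcc, mem_setOf_eq] at hj
    simp only [rowIco, mem_setOf_eq]
    omega
  · exact PlanarDuality.openConnIn_trans hxy
      (by rw [openConnIn_comm]; exact openConnIn_mono (hb_subset_halfPlane k R) _ _ hjz)

/-- `μ` is the tree's `P_{1/2}`. [folklore] -/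
theorem mu_eq : μ = bondPercolation (zdGraph 2) half := rfl

/-- **Domination through the two-arm point bound**: given STUB A's bound `P[liso k R] ≤ C/R`
(hypothesis `hA`, in its registered unfolded form), `P[E(k)] ≤ C/R` whenever `β < k − R`,
`γ ≤ k − R`, `R ≥ 1`. [folklore] -/
theorem measureReal_firstHit_le_of_twoArm {C : ℝ}
    (hA : ∀ (k : ℤ) (R : ℕ), 1 ≤ R →
      μ.real (openCrossing {v : Site 2 | 0 ≤ v 1 ∧ v 1 ≤ (R : ℤ) ∧ k - R ≤ v 0 ∧ v 0 ≤ k + R} {bpt k}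
            {v : Site 2 | v 0 = k - R ∨ v 0 = k + R ∨ v 1 = (R : ℤ)} \
          openCrossing {v : Site 2 | 0 ≤ v 1 ∧ v 1 ≤ (R : ℤ) ∧ k - R ≤ v 0 ∧ v 0 ≤ k + R}
            (rowIcc (k - R) (k - 1)) {bpt k}) ≤ C / R)
    {α β γ k : ℤ} {R : ℕ} (hR : 1 ≤ R) (hβ : β < k - R) (hγ : γ ≤ k - R) :
    μ.real (firstHit halfPlane (rowIcc α β) γ k) ≤ C / R := by
  refine le_trans ?_ (hA k R hR)
  change μ.real (firstHit halfPlane (rowIcc α β) γ k) ≤ μ.real (liso k R)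
  rw [measureReal_def, measureReal_def]
  refine ENNReal.toReal_mono (measure_ne_top _ _) (measure_mono_ae ?_)
  rw [mu_eq]
  filter_upwards [ae_subset_edgeSet (zdGraph 2) half] with ω hω
  exact fun h ↦ firstHit_subset_liso hβ hγ hω h

/-! ### The short-arc bound (RSW annulus decay) -/

/-- Real part of a lattice site at mesh `1`. [folklore] -/
theorem meshPoint_one_re (v : Site 2) : (meshPoint 1 v).re = (v 0 : ℝ) := by
  rw [meshPoint_re, one_mul]

/-- Imaginary part of a lattice site at mesh `1`. [folklore] -/
theorem meshPoint_one_im (v : Site 2) : (meshPoint 1 v).im = (v 1 : ℝ) := by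
  rw [meshPoint_im, one_mul]

/-- Horizontal separation bounds the distance from below. [folklore] -/
theorem abs_sub_le_dist_meshPoint (u v : Site 2) :
    |((u 0 : ℝ) - v 0)| ≤ dist (meshPoint 1 u) (meshPoint 1 v) := by
  rw [dist_eq_norm, ← meshPoint_one_re u, ← meshPoint_one_re v, ← Complex.sub_re]
  exact Complex.abs_re_le_norm _

/-- The `ℓ¹` bound on the distance between two lattice sites. [folklore] -/
theorem dist_meshPoint_le (u v : Site 2) :
    dist (meshPoint 1 u) (meshPoint 1 v) ≤ |((u 0 : ℝ) - v 0)| + |((u 1 : ℝ) - v 1)| := by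
  rw [dist_eq_norm, ← meshPoint_one_re u, ← meshPoint_one_re v, ← Complex.sub_re,
    ← meshPoint_one_im u, ← meshPoint_one_im v, ← Complex.sub_im]
  exact Complex.norm_le_abs_re_add_abs_im _

/-- Adjacent lattice sites are at distance `≤ 1`. [folklore] -/
theorem dist_meshPoint_le_one_of_adj {u v : Site 2} (h : (zdGraph 2).Adj u v) :
    dist (meshPoint 1 u) (meshPoint 1 v) ≤ 1 := by
  refine (dist_meshPoint_le u v).trans ?_
  rcases (zdGraph_adj_iff u v).1 h with ⟨i, h | h⟩ <;> fin_cases i <;>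
    · have h0 := congr_fun h 0
      have h1 := congr_fun h 1
      simp at h0 h1
      simp only [h0, h1]
      push_cast
      norm_num

/-- **Truncation**: a lattice configuration joining the window `[⌊cn⌋,⌊xn⌋]×{0}` to the far arc
`A_n` inside the half-plane crosses the annulus of radii `r = ⌊xn⌋ − ⌊cn⌋`, `R'` around `(⌊cn⌋,0)`
(in the tree's `annulusOpenCrossing` form, mesh `1`), provided `⌊cn⌋ − ⌊bn⌋ ≥ R' > r`. [folklore] -/
theorem mem_annulusOpenCrossing_of_crossing {ω : BondConfig (Site 2)} (hω : ω ⊆ (zdGraph 2).edgeSet)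
    {a b c x : ℝ} {n : ℕ} {R' : ℝ} (hrR : ((⌊x * n⌋ - ⌊c * n⌋ : ℤ) : ℝ) < R')
    (hfar : R' ≤ ((⌊c * n⌋ - ⌊b * n⌋ : ℤ) : ℝ))
    (h : ω ∈ openCrossing halfPlane (arcA a b n) (rowIcc ⌊c * n⌋ ⌊x * n⌋)) :
    ω ∈ annulusOpenCrossing (meshPoint 1 (bpt ⌊c * n⌋)) 1 ((⌊x * n⌋ - ⌊c * n⌋ : ℤ) : ℝ) R' := by
  obtain ⟨w, hw, u, hu, hwu⟩ := h
  simp only [arcA, mem_setOf_eq] at hw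
  simp only [rowIcc, mem_setOf_eq] at hu
  have hbc : ⌊b * (n : ℝ)⌋ < ⌊c * (n : ℝ)⌋ := by
    have h0 : (0 : ℝ) ≤ ((⌊x * n⌋ - ⌊c * n⌋ : ℤ) : ℝ) := by exact_mod_cast (by omega : (0 : ℤ) ≤ ⌊x * n⌋ - ⌊c * n⌋)
    have h1 : (0 : ℝ) < ((⌊c * n⌋ - ⌊b * n⌋ : ℤ) : ℝ) := by linarith
    have h2 : (0 : ℤ) < ⌊c * n⌋ - ⌊b * n⌋ := by exact_mod_cast h1
    omega
  set z₀ := meshPoint 1 (bpt ⌊c * n⌋) with hz₀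
  have hu_dist : dist (meshPoint 1 u) z₀ ≤ ((⌊x * n⌋ - ⌊c * n⌋ : ℤ) : ℝ) := by
    refine (dist_meshPoint_le u (bpt ⌊c * n⌋)).trans ?_
    simp only [bpt, Matrix.cons_val_zero, Matrix.cons_val_one, Matrix.cons_val_fin_one, hu.1,
      Int.cast_zero, sub_zero, abs_zero, add_zero]
    rw [abs_of_nonneg (by exact_mod_cast (sub_nonneg.2 hu.2.1))]
    push_cast
    exact_mod_cast (by omega : u 0 - ⌊c * (n : ℝ)⌋ ≤ ⌊x * (n : ℝ)⌋ - ⌊c * n⌋)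
  have hw_dist : R' ≤ dist (meshPoint 1 w) z₀ := by
    refine hfar.trans (le_trans ?_ (abs_sub_le_dist_meshPoint w (bpt ⌊c * n⌋)))
    simp only [bpt, Matrix.cons_val_zero]
    rw [abs_sub_comm, abs_of_nonneg (by exact_mod_cast (by omega : (0 : ℤ) ≤ ⌊c * (n : ℝ)⌋ - w 0))]
    push_cast
    exact_mod_cast (by omega : ⌊c * (n : ℝ)⌋ - ⌊b * (n : ℝ)⌋ ≤ ⌊c * (n : ℝ)⌋ - w 0)
  have huw : ω ∈ openConnIn halfPlane u w := by rw [openConnIn_comm]; exact hwu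
  set T : Set (Site 2) := {v | dist (meshPoint 1 v) z₀ < R'} with hT
  have huT : u ∈ T := lt_of_le_of_lt hu_dist hrR
  have hwT : w ∉ T := fun h ↦ absurd (lt_of_le_of_lt hw_dist h) (lt_irrefl _)
  obtain ⟨u', w', hu', hw', hw'S, he, hne, hconn⟩ := exists_openConnIn_exit huT hwT huw
  have hadj : (zdGraph 2).Adj u' w' := by
    have := hω he
    rwa [SimpleGraph.mem_edgeSet] at this
  set S' : Set (Site 2) := {v | dist (meshPoint 1 v) z₀ ≤ R' + 2 * 1} with hS'
  have hTS' : halfPlane ∩ T ⊆ S' := fun v hv ↦ by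
    have := hv.2; simp only [hT, mem_setOf_eq] at this; simp only [hS', mem_setOf_eq]; linarith
  have hu'S' : u' ∈ S' := hTS' hconn.2.1
  have hw'S'' : w' ∈ S' := by
    simp only [hS', mem_setOf_eq]
    have h1 : dist (meshPoint 1 w') (meshPoint 1 u') ≤ 1 := by
      rw [dist_comm]; exact dist_meshPoint_le_one_of_adj hadj
    have h2 : dist (meshPoint 1 u') z₀ < R' := hu'
    have h3 := dist_triangle (meshPoint 1 w') (meshPoint 1 u') z₀
    linarith
  have hw'far : R' ≤ dist (meshPoint 1 w') z₀ := not_lt.1 hw'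
  refine ⟨u, hu_dist, w', hw'far, ?_⟩
  exact PlanarDuality.openConnIn_trans (openConnIn_mono hTS' _ _ hconn)
    (openConnIn_of_adj hu'S' hw'S'' he hne)

/-- **The short-arc bound**: there is `α > 0` such that for `a < b < c < x` with `x − c ≤ (c−b)/8`,
eventually in `n`, `P[A_n ↔ [⌊cn⌋,⌊xn⌋]×{0} in ℤ×ℕ] ≤ (4(x−c)/(c−b))^α`
(RSW polynomial decay of annulus crossings, tree fact `annulusOpenCrossing_half_le_holds`). [folklore] -/
theorem stub_shortArc :
    ∃ α : ℝ, 0 < α ∧ ∀ a b c x : ℝ, a < b → b < c → c < x → x - c ≤ (c - b) / 8 →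
      ∀ᶠ n : ℕ in atTop, μ.real (openCrossing halfPlane (arcA a b n) (rowIcc ⌊c * n⌋ ⌊x * n⌋)) ≤
        (4 * (x - c) / (c - b)) ^ α := by
  obtain ⟨α, c₀, hα, hc₀, hbound⟩ := annulusOpenCrossing_half_le_holds
  refine ⟨α, hα, fun a b c x _ hbc hcx hxc ↦ ?_⟩
  have hxc0 : 0 < x - c := sub_pos.2 hcx
  have hcb0 : 0 < c - b := sub_pos.2 hbc
  have h1 : ∀ᶠ n : ℕ in atTop, c₀ + 1 ≤ (x - c) * n :=
    (tendsto_natCast_atTop_atTop.const_mul_atTop hxc0).eventually_ge_atTop _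
  have h2 : ∀ᶠ n : ℕ in atTop, (8 : ℝ) ≤ (c - b) * n :=
    (tendsto_natCast_atTop_atTop.const_mul_atTop hcb0).eventually_ge_atTop _
  have h3 : ∀ᶠ n : ℕ in atTop, (1 : ℝ) ≤ (x - c) * n :=
    (tendsto_natCast_atTop_atTop.const_mul_atTop hxc0).eventually_ge_atTop _
  filter_upwards [h1, h2, h3] with n hn1 hn2 hn3
  set r : ℝ := ((⌊x * n⌋ - ⌊c * n⌋ : ℤ) : ℝ) with hr
  set R' : ℝ := (c - b) * n / 2 with hR'
  -- floor bookkeeping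
  have hr_lo : (x - c) * n - 1 ≤ r := by
    rw [hr]; push_cast
    have := Int.floor_le (c * n); have := Int.lt_floor_add_one (x * n); nlinarith
  have hr_hi : r ≤ (x - c) * n + 1 := by
    rw [hr]; push_cast
    have := Int.floor_le (x * n); have := Int.lt_floor_add_one (c * n); nlinarith
  have hfar : R' ≤ ((⌊c * n⌋ - ⌊b * n⌋ : ℤ) : ℝ) := by
    push_cast
    have := Int.floor_le (b * n); have := Int.lt_floor_add_one (c * n)
    rw [hR']; nlinarith
  have hc₀r : c₀ * 1 ≤ r := by linarith
  have h2r : 2 * r ≤ R' := by rw [hR']; nlinarith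
  have hrR : r < R' := by nlinarith
  have hincl : μ.real (openCrossing halfPlane (arcA a b n) (rowIcc ⌊c * n⌋ ⌊x * n⌋)) ≤
      μ.real (annulusOpenCrossing (meshPoint 1 (bpt ⌊c * n⌋)) 1 r R') := by
    rw [measureReal_def, measureReal_def]
    refine ENNReal.toReal_mono (measure_ne_top _ _) (measure_mono_ae ?_)
    rw [mu_eq]
    filter_upwards [ae_subset_edgeSet (zdGraph 2) half] with ω hω
    exact fun h ↦ mem_annulusOpenCrossing_of_crossing hω hrR hfar h
  refine hincl.trans ((mu_eq ▸ hbound _ 1 r R' one_pos hc₀r h2r).trans ?_)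
  have hR'0 : 0 < R' := by rw [hR']; positivity
  have hratio : r / R' ≤ 4 * (x - c) / (c - b) := by
    rw [div_le_div_iff₀ hR'0 hcb0, hR']
    nlinarith
  exact Real.rpow_le_rpow (div_nonneg (by linarith) hR'0.le) hratio hα.le

end Converse

end Summit.CriticalPhenomena.CardyFormulaZ2.Cruxes.HalfPlaneMarkDensityLaw.SketchLine
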